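import Summits.QuantumFields.YangMills.Theorems.BalabanUVNodesN15KingModelReflectionPositivity
import Summits.QuantumFields.YangMills.Theorems.BalabanUVNodesN15KingModelAxisSpectralRepresentation
import Summits.QuantumFields.YangMills.Theorems.BalabanUVNodesN15KingModelEffectiveMass

/-!
# BalabanUVNodes ∕ N15 — THE KING-MODEL RUNG: PART Ϸ (sho) BY NAME — the decay ∕ positivity ∕ spectral package of King's continuum block two-point function
# `S₂^{ℝ}` in one theorem (Track A, DAG node N15 = NE2; FAN-OUT v1.1 §N15 s3 «KING-MODEL RUNG»; an index theorem like part Ϝ's `king_partDigamma_package`;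
# count-neutral)

HONEST FRAMING.  Count-neutral (cell `pub-ymgap`, seat `pub-ymgap-dag-n15-e` g34; `--supports stmt-QuantumFields-27366 --as helper` = K3⁸
`SpineGivenEndpointR13SepCoPHV`).  King's `A = 0`, `g = 0` model ([King1986] C. King, Commun. Math. Phys. **102** (1986) 649–677): `S₂^{ℝ}(z)`, `z ∈ ℤ^{d+1}`,
the infinite-volume two-point function of the unit-block averages of the continuum free field of mass `m = √m²` ((4.5) p.670, (4.36) p.674) — the `K → ∞`,
`|Ω| → ∞` limit of King's block-spin covariances (parts Ϝ, Ϸ-d∕f).  This file only CONJOINS, by name, what parts Ϸ-c … Ϸ-o proved about it, as a single entry point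
for referees: (1) clustering at EVERY rate `c < m` in every direction with an explicit prefactor (Ϸ-c, Paley–Wiener); (2) strict positivity on the axes (Ϸ-j);
(3) the one-step transfer contraction `S((t+1)e_ν) ≤ e^{−m}S(te_ν)` (Ϸ-m); (4) log-convexity (Ϸ-o); (5) the EXACT correlation length `lim|S(te_ν)|^{1∕t} = e^{−m}`
(Ϸ-e∕j); (6) the lattice effective mass `m_eff(t) ↓ m` (Ϸ-o); (7) reflection positivity of the covariance under block reflections (Ϸ-k); (8) the spectral
representation on the axes by a finite measure carried by `[m,∞)` (Ϸ-n).  NOT a node discharge (N15 is booked through n15-a's knit, untouched here); nothing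
Bałaban ∕ continuum-Yang–Mills ∕ `ℝ⁴` ∕ OS reconstruction ∕ Clay; every item is about the FREE block field and its mass `m`.  0 `sorry`, 0 def; standard axioms.

WHAT THIS FILE PROVES (kernel).  ★★★ **`king_partSho_package`** (the eight-part conjunction, each conjunct a named theorem of parts Ϸ-c…o).

HONEST SCOPE.  Index theorem; no new mathematics beyond its conjuncts.  N15 untouched; counts unmoved.  Locators (use): [King1986] (4.5) p.670, (4.36) p.674,
Thm 3.3 (3.6) p.655, Thm 2.1 (2.22)–(2.23) p.654.
-/

noncomputable section

open scoped BigOperators Topology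
open Filter MeasureTheory Set

namespace Summit.QuantumFields.YangMills.BalabanUVNodes.N15KingModelRung.OptimalDecay

variable {d : ℕ}

/-- ★★★ **PART Ϸ BY NAME — THE DECAY ∕ POSITIVITY ∕ SPECTRAL PACKAGE OF `S₂^{ℝ}`** (`m² > 0`, direction `ν`):
(1) `|S₂^{ℝ}(z)| ≤ (2π)^{−(d+1)}·2π(1+cosh c)∕(c(m²−c²))·((17+16π²)π)^d·e^{−c|z_ν|}` for every `0 < c`, `c² < m²`, every `z` (part Ϸ-c);
(2) `S₂^{ℝ}(te_ν) > 0` for every integer `|t| ≥ 1` (Ϸ-j);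
(3) `S₂^{ℝ}((t+1)e_ν) ≤ e^{−√m²}S₂^{ℝ}(te_ν)`, `t ≥ 1` (Ϸ-m);
(4) `S₂^{ℝ}((t+1)e_ν)² ≤ S₂^{ℝ}(te_ν)S₂^{ℝ}((t+2)e_ν)`, `t ≥ 1` (Ϸ-o);
(5) `|S₂^{ℝ}(te_ν)|^{1∕t} → e^{−√m²}` (Ϸ-e∕j);
(6) `log(S₂^{ℝ}(te_ν)∕S₂^{ℝ}((t+1)e_ν)) → √m²` (Ϸ-o);
(7) `0 ≤ Σ_{i,j∈s}c_i c_j S₂^{ℝ}(θ_ν z_i − z_j)` for half-lattice sites `(z_i)_ν ≥ 0` (Ϸ-k);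
(8) `∃ρ` finite on `ℝ`, `ρ((−∞,√m²)) = 0`, `S₂^{ℝ}(te_ν) = ∫e^{−λ(|t|−1)}dρ` for all `|t| ≥ 1`, `ρ(ℝ) = S₂^{ℝ}(e_ν)` (Ϸ-n).
[cite: King1986, (4.5) p.670, (4.36) p.674, Thm 3.3 (3.6) p.655, Thm 2.1 (2.22)–(2.23) p.654] -/
theorem king_partSho_package {m2 : ℝ} (hm : 0 < m2) (ν : Fin (d + 1)) :
    (∀ c : ℝ, 0 < c → c ^ 2 < m2 → ∀ z : Fin (d + 1) → ℤ,
        |kingS2Inf m2 z| ≤ ((2 * Real.pi) ^ (d + 1))⁻¹ * (2 * Real.pi * (1 + Real.cosh c) / (c * (m2 - c ^ 2))) * ((17 + 16 * Real.pi ^ 2) * Real.pi) ^ d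
          * Real.exp (-(c * |(z ν : ℝ)|)))
    ∧ (∀ t : ℤ, 1 ≤ |(t : ℝ)| → 0 < kingS2Inf m2 (Pi.single ν t))
    ∧ (∀ t : ℕ, 1 ≤ t → kingS2Inf m2 (Pi.single ν (((t + 1 : ℕ)) : ℤ)) ≤ Real.exp (-Real.sqrt m2) * kingS2Inf m2 (Pi.single ν ((t : ℕ) : ℤ)))
    ∧ (∀ t : ℕ, 1 ≤ t → kingS2Inf m2 (Pi.single ν (((t + 1 : ℕ)) : ℤ)) ^ 2
        ≤ kingS2Inf m2 (Pi.single ν ((t : ℕ) : ℤ)) * kingS2Inf m2 (Pi.single ν (((t + 2 : ℕ)) : ℤ)))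
    ∧ Tendsto (fun t : ℕ => |kingS2Inf m2 ((t : ℤ) • (Pi.single ν (1 : ℤ) : Fin (d + 1) → ℤ))| ^ ((t : ℝ)⁻¹)) atTop (𝓝 (Real.exp (-Real.sqrt m2)))
    ∧ Tendsto (fun t : ℕ => Real.log (kingS2Inf m2 (Pi.single ν ((t : ℕ) : ℤ)) / kingS2Inf m2 (Pi.single ν (((t + 1 : ℕ)) : ℤ)))) atTop (𝓝 (Real.sqrt m2))
    ∧ (∀ (ι : Type) (s : Finset ι) (c : ι → ℝ) (z : ι → Fin (d + 1) → ℤ), (∀ i ∈ s, 0 ≤ z i ν) →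
        0 ≤ ∑ i ∈ s, ∑ j ∈ s, c i * c j * kingS2Inf m2 (Function.update (z i) ν (-(z i ν) - 1) - z j))
    ∧ (∃ ρ : Measure ℝ, IsFiniteMeasure ρ ∧ ρ (Iio (Real.sqrt m2)) = 0
        ∧ (∀ t : ℤ, 1 ≤ |(t : ℝ)| → kingS2Inf m2 (Pi.single ν t) = ∫ l, Real.exp (-(l * (|(t : ℝ)| - 1))) ∂ρ)
        ∧ (ρ univ).toReal = kingS2Inf m2 (Pi.single ν 1)) :=
  ⟨fun _ hc0 hc z => abs_kingS2Inf_le_exp_of_sq_lt hm hc0 hc z ν,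
    fun _ ht => kingS2Inf_single_pos hm ν ht,
    fun _ ht => kingS2Inf_single_succ_le hm ν ht,
    fun _ ht => kingS2Inf_single_logConvex hm ν ht,
    tendsto_rpow_abs_kingS2Inf_axis hm ν,
    tendsto_log_kingS2Inf_ratio hm ν,
    fun _ s c z hz => kingS2Inf_reflection_positive hm ν s c z hz,
    kingS2Inf_axis_spectral_representation hm ν⟩

end Summit.QuantumFields.YangMills.BalabanUVNodes.N15KingModelRung.OptimalDecay
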